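import Literature.AlgebraicGeometry.Motives.EtaleToProetExt
import Literature.AlgebraicGeometry.Motives.EtaleToProetLanProofs
import Literature.AlgebraicGeometry.Motives.ProetLimOneSequenceProofs
import HarnessLib

/-!
# Bhatt–Scholze Prop. 5.6.2 for the tower `(ℤ/ℓᵐ)_m`: the `lim¹` sequence with ÉTALE towers
# (`ellAdicCohomology_limOneSequence`) reduced to Cor. 5.1.6

The named fact `Literature.AlgebraicGeometry.Motives.ellAdicCohomology_limOneSequence`
(`EllAdicComparison.lean`) is Bhatt–Scholze Prop. 5.6.2 read for `F_m = ℤ/ℓᵐ`: for every scheme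
`Y`, prime `ℓ` and `i ≥ 0` an exact sequence
`0 → lim¹_m Hⁱ(Y_ét, ℤ/ℓᵐ) —δ→ Hⁱ⁺¹_proét(Y, ℤ_ℓ) —ρ→ lim_m Hⁱ⁺¹(Y_ét, ℤ/ℓᵐ) → 0` with ÉTALE groups
(Mathlib `Sheaf.H` of the constant sheaves on `Y.Etale`) inside the limits and Mathlib's
`Scheme.EllAdicCohomology` in the middle. Its printed proof (arXiv p. 34):
`RΓ(Y_ét, R lim F_m) = R lim RΓ(Y_ét, F_m) = R lim RΓ(Y_proét, ν*F_m) = RΓ(Y_proét, R lim ν*F_m)`,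
"the second equality comes from the boundedness of `F_n`" — i.e. from **Cor. 5.1.6**
(`K ≃ ν_*ν*K` on `D⁺(Y_ét)`) — and `R lim ν*F_m = lim ν*F_m` by repleteness (Prop. 3.1.10), the
`lim¹` sequence being the triangle `R lim → ∏ → ∏` (Prop. 3.1.11).

The pro-étale half of this argument is PROVED in the tree: `ProetLimOneSequence.lean` derives the
`lim¹` sequence with PRO-ÉTALE towers `Hⁱ(Y_proét, ℤ/ℓᵐ)` (`proetCohomology_limOneSequence_of_piComparison`)
from the long exact cohomology sequence of `0 → F_{ℤ_ℓ} → F_{∏ℤ/ℓᵐ} → F_{∏ℤ/ℓᵐ} → 0`, and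
`ProetLimOneSequenceProofs.lean` discharges its only input, the commutation of `Hⁱ(Y_proét, –)`
with countable products (Prop. 3.1.9, `bijective_piComparison_proetCohomology_holds`). What was
missing (design notes of `ProetLimOneSequence.lean`: "a comparison of the pro-étale tower with the
étale tower compatible with the transition maps … the vendored bridges `nonempty_addEquiv_…` are
not natural in the coefficients") is supplied here, so that **`ellAdicCohomology_limOneSequence`
is reduced to Bhatt–Scholze Cor. 5.1.6** (`nonempty_addEquiv_sheafH_etaleToProetPullback`,
`EtaleToProet.lean`), the one remaining unproved input of the whole comparison:

* `sheafHEquivEtaleToProetPullback_naturality` — the canonical comparison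
  `Hⁱ(X_ét, F) ≃+ Hⁱ(X_proét, ν*F)` of `EtaleToProetExt.lean` (`Ext.mapExactFunctor (ν* ∘ ulift)`,
  Cor. 5.1.9 by dimension shifting, under the acyclicity hypothesis `hc` of that file and the proved
  full faithfulness of `ν*`, `full_faithful_etaleToProetPullback_holds`) is NATURAL in `F`
  (Mathlib `Ext.mapExactFunctor_comp`, `Ext.mapExactFunctor_mk₀`);
* `constantSheafIsoContinuousMapEtSheaf_hom_naturality`, `…ULift…`, `constantSheafIsoContinuousMapProetSheaf_hom_naturality`,
  `etaleToProetPullbackULiftConstantIso_hom_naturality` — Milne II 2.18 (a) / Bhatt–Scholze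
  Lemma 4.2.12 (`M_X ≅ (U ↦ C(U, M))` on both sites) and `ν*(M_X^{ét}) ≅ M_X^{proét}` are natural in
  the discrete group `M` (one general lemma, `sheafifyCompIso_hom_naturality`: sheafified locally
  bijective comparison maps are natural);
* `etaleConstHEquivProetCohomology(_naturality)` — hence `Hⁱ(X_ét, M) ≃+ Hⁱ(X_proét, F_M)`
  naturally in `M`, and `etaleProetZModPowEquiv(_map)`: **the towers `Hⁱ(Y_ét, ℤ/ℓᵐ)` and
  `Hⁱ(Y_proét, ℤ/ℓᵐ)` are isomorphic as towers**;
* `towerLimCongr`, `towerLimOneCongr`, `exact_pair_congr` — `lim`, `lim¹` and exact pairs along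
  isomorphisms of towers (algebra);
* **`ellAdicCohomology_limOneSequence_of_acyclic`**, **`ellAdicCohomology_limOneSequence_of_pullback`**
  — the named fact from the acyclicity of the `ν*I` (`Hᵖ⁺¹(X_proét, ν*I) = 0`, `I` injective),
  resp. from Cor. 5.1.6 itself (which implies the acyclicity,
  `subsingleton_sheafH_etaleToProetPullbackULift_of_pullback`).

So the trust base of `ellAdicCohomology_limOneSequence` (and, through it, of the finiteness and
top-degree statements of this cluster that take it as `h₃`) is now
{`nonempty_addEquiv_sheafH_etaleToProetPullback`} = Bhatt–Scholze Cor. 5.1.6.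

## References

* B. Bhatt, P. Scholze, *The pro-étale topology for schemes*, Astérisque 369 (2015)
  (arXiv:1309.1198, held; arXiv pages): Prop. 3.1.9–3.1.11 (p. 15–16), Lemma 4.2.12 (p. 25),
  Lemma 5.1.1, Lemma 5.1.2, Cor. 5.1.6 and its proof, Cor. 5.1.9 (pp. 29–30), Def. 5.6.1 and
  Prop. 5.6.2 with proof (p. 34), Def. 6.8.1, Lemma 6.8.2 (p. 48). [BhattScholze2015]
* J. S. Milne, *Étale cohomology* (reissue 2025): II Examples 2.18 (a) (constant sheaves).
  [Milne2025]

## Design notes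

* No statement is changed and no named fact is introduced: the file only proves theorems (and the
  data of the comparison isomorphisms) over `EllAdicComparison.lean`, `EtaleToProetExt.lean`,
  `EtaleToProetLanProofs.lean`, `ProetLimOneSequence(Proofs).lean`.
* The acyclicity hypothesis is spelled out exactly as the `hc` of `EtaleToProetExt.lean` (it is the
  residual proof obligation of Cor. 5.1.6 there, deliberately not a named fact, D-0026).
* `etaleConstHEquivProetCohomology` lands in `(proetSheaf X M).H i`, which is
  `ProetCohomology X M i` by `rfl`; statements are kept on these syntactic carriers so that
  `Sheaf.H.map_comp_apply` rewrites, and the identification with `proetCohomologyZModPow` /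
  `Scheme.EllAdicCohomology` (`proetCohomology_padicInt`) happens by definitional unfolding in the
  final assembly only.
* `δ` and `ρ` of the conclusion are the maps of `proetCohomology_limOneSequence_of_piComparison`
  (connecting map of the product coefficient sequence; `z ↦ (z mod ℓᵐ)_m`) composed with the tower
  isomorphisms — canonical, although the named fact only asks for existence.
* Mathlib searches: `Ext.mapExactFunctor_comp`, `Ext.mapExactFunctor_mk₀`,
  `Ext.comp_assoc_of_third_deg_zero`, `sheafificationNatIso`, `QuotientAddGroup.congr`,
  `AddEquiv.piCongrRight`; Literature: `towerLim.map` (`EllAdicEtalePullback.lean`, functoriality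
  of `lim` for morphisms of towers, heavier imports; the two `…Congr` equivalences here are the
  invertible case, kept local). Nothing restated.
-/

universe w' w v' u' v u

open CategoryTheory Limits Opposite AlgebraicGeometry Literature.Algebra.InverseSystem

noncomputable section

namespace Literature.AlgebraicGeometry.Motives

/-! ### Towers of abelian groups: `lim` and `lim¹` along an isomorphism of towers -/

section TowerCongr

variable {A : ℕ → Type v} {B : ℕ → Type v'} [∀ m, AddCommGroup (A m)] [∀ m, AddCommGroup (B m)]
  (f : ∀ m, A (m + 1) →+ A m) (g : ∀ m, B (m + 1) →+ B m) (e : ∀ m, A m ≃+ B m)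

/-- An isomorphism of towers `e_m : A_m ≃+ B_m` (commuting with the transition maps) induces
`∏_m A_m ≃+ ∏_m B_m` intertwining the two maps `(a_m) ↦ (a_m - f_m a_{m+1})` (`towerDiff`).
[folklore] -/
theorem piCongrRight_towerDiff (he : ∀ m (a : A (m + 1)), e m (f m a) = g m (e (m + 1) a))
    (a : ∀ m, A m) :
    AddEquiv.piCongrRight e (towerDiff f a) = towerDiff g (AddEquiv.piCongrRight e a) := by
  funext m
  simp [towerDiff_apply, he]

/-- `lim` along an isomorphism of towers: `lim_m A_m ≃+ lim_m B_m`, componentwise `e_m`.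
[folklore] -/
def towerLimCongr (he : ∀ m (a : A (m + 1)), e m (f m a) = g m (e (m + 1) a)) :
    towerLim f ≃+ towerLim g where
  toFun x := ⟨fun m => e m ((x : ∀ m, A m) m), (mem_towerLim_iff g).2 fun m => by
    rw [← he, (mem_towerLim_iff f).1 x.2 m]⟩
  invFun y := ⟨fun m => (e m).symm ((y : ∀ m, B m) m), (mem_towerLim_iff f).2 fun m => by
    apply (e m).injective
    rw [he, AddEquiv.apply_symm_apply, AddEquiv.apply_symm_apply, (mem_towerLim_iff g).1 y.2 m]⟩
  left_inv x := by ext m; exact (e m).symm_apply_apply _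
  right_inv y := by ext m; exact (e m).apply_symm_apply _
  map_add' x y := by ext m; exact map_add (e m) _ _

/-- Components of `towerLimCongr`: `(towerLimCongr x)_m = e_m x_m`. [folklore] -/
@[simp] theorem coe_towerLimCongr_apply
    (he : ∀ m (a : A (m + 1)), e m (f m a) = g m (e (m + 1) a)) (x : towerLim f) (m : ℕ) :
    (towerLimCongr f g e he x : ∀ m, B m) m = e m ((x : ∀ m, A m) m) := rfl

/-- `lim¹` along an isomorphism of towers: `lim¹_m A_m ≃+ lim¹_m B_m` (the isomorphism
`∏ A_m ≃+ ∏ B_m` maps the image of `towerDiff f` onto the image of `towerDiff g`). [folklore] -/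
def towerLimOneCongr (he : ∀ m (a : A (m + 1)), e m (f m a) = g m (e (m + 1) a)) :
    TowerLimOne f ≃+ TowerLimOne g :=
  QuotientAddGroup.congr (towerDiff f).range (towerDiff g).range (AddEquiv.piCongrRight e) (by
    ext b
    simp only [AddSubgroup.mem_map, AddMonoidHom.mem_range, AddMonoidHom.coe_coe,
      exists_exists_eq_and]
    constructor
    · rintro ⟨a, rfl⟩
      exact ⟨AddEquiv.piCongrRight e a, (piCongrRight_towerDiff f g e he a).symm⟩
    · rintro ⟨a, rfl⟩
      exact ⟨(AddEquiv.piCongrRight e).symm a, by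
        rw [piCongrRight_towerDiff f g e he, AddEquiv.apply_symm_apply]⟩)

/-- `towerLimOneCongr` on classes: `[a] ↦ [(e_m a_m)_m]`. [folklore] -/
@[simp] theorem towerLimOneCongr_mk
    (he : ∀ m (a : A (m + 1)), e m (f m a) = g m (e (m + 1) a)) (a : ∀ m, A m) :
    towerLimOneCongr f g e he (TowerLimOne.mk f a) =
      TowerLimOne.mk g (AddEquiv.piCongrRight e a) :=
  rfl

end TowerCongr

/-- Transport of an exact pair `L —δ→ M —ρ→ N` (`δ` injective, `ρ` surjective, `range δ = ker ρ`)
along isomorphisms `L' ≃+ L` and `N ≃+ N'`. [folklore] -/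
theorem exact_pair_congr {L L' M N N' : Type*} [AddCommGroup L] [AddCommGroup L'] [AddCommGroup M]
    [AddCommGroup N] [AddCommGroup N'] (δ : L →+ M) (ρ : M →+ N) (eL : L' ≃+ L) (eN : N ≃+ N')
    (hδ : Function.Injective δ) (hρ : Function.Surjective ρ) (h : δ.range = ρ.ker) :
    Function.Injective (δ.comp eL.toAddMonoidHom) ∧
      Function.Surjective (eN.toAddMonoidHom.comp ρ) ∧
        (δ.comp eL.toAddMonoidHom).range = (eN.toAddMonoidHom.comp ρ).ker := by
  refine ⟨hδ.comp eL.injective, eN.surjective.comp hρ, ?_⟩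
  ext m
  simp only [AddMonoidHom.mem_range, AddMonoidHom.coe_comp, AddEquiv.coe_toAddMonoidHom,
    Function.comp_apply, AddMonoidHom.mem_ker, EmbeddingLike.map_eq_zero_iff]
  rw [← AddMonoidHom.mem_ker, ← h, AddMonoidHom.mem_range]
  constructor
  · rintro ⟨l', rfl⟩
    exact ⟨eL l', rfl⟩
  · rintro ⟨l, rfl⟩
    exact ⟨eL.symm l, by rw [AddEquiv.apply_symm_apply]⟩

/-! ### Sheafified comparison maps are natural -/

section SheafifyNatural

variable {C : Type u'} [Category.{v'} C] {J : GrothendieckTopology C} {D : Type w}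
  [Category.{w'} D] [HasWeakSheafify J D]

/-- If `c : P ⟶ S` and `c' : P' ⟶ S'` are morphisms from presheaves to (the underlying presheaves
of) sheaves which become isomorphisms after sheafification, then the induced isomorphisms
`P^# ≅ S`, `P'^# ≅ S'` (sheafify `c`, then undo the sheafification of the sheaf `S`, Mathlib
`sheafificationIso`) are natural with respect to any compatible pair `p : P ⟶ P'`, `g : S ⟶ S'`.
[folklore] -/
theorem sheafifyCompIso_hom_naturality {P P' : Cᵒᵖ ⥤ D} {S S' : Sheaf J D} (c : P ⟶ S.obj)
    (c' : P' ⟶ S'.obj) [IsIso ((presheafToSheaf J D).map c)]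
    [IsIso ((presheafToSheaf J D).map c')] (p : P ⟶ P') (g : S ⟶ S') (hpg : p ≫ c' = c ≫ g.hom) :
    (presheafToSheaf J D).map p ≫
        (asIso ((presheafToSheaf J D).map c') ≪≫ (sheafificationIso S').symm).hom =
      (asIso ((presheafToSheaf J D).map c) ≪≫ (sheafificationIso S).symm).hom ≫ g := by
  simp only [Iso.trans_hom, asIso_hom, Iso.symm_hom]
  rw [← Category.assoc, ← Functor.map_comp, hpg, Functor.map_comp, Category.assoc,
    Category.assoc]
  congr 1
  rw [Iso.comp_inv_eq, Category.assoc, Iso.eq_inv_comp]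
  exact ((sheafificationNatIso J D).hom.naturality g).symm

end SheafifyNatural

/-! ### Coefficient homomorphisms and the sheaves of continuous maps on `X_ét` -/

section Coefficients

variable {M N : Type} [AddCommGroup M] [AddCommGroup N]

/-- An additive map `φ : M → N` as a morphism `ULift M ⟶ ULift N` of `Ab.{w}` (conjugation by
`ULift`; for `φ` the reduction `ℤ/ℓᵐ⁺¹ → ℤ/ℓᵐ` and `w = u` this is `zmodPowAbRed ℓ m` of
`EllAdicComparison.lean`, by `rfl`). [folklore] -/
def ofHomULift (φ : M →+ N) :
    AddCommGrpCat.of (ULift.{w} M) ⟶ AddCommGrpCat.of (ULift.{w} N) :=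
  AddCommGrpCat.ofHom <| AddEquiv.ulift.symm.toAddMonoidHom.comp <|
    φ.comp AddEquiv.ulift.toAddMonoidHom

/-- `ofHomULift φ` is `⟨m⟩ ↦ ⟨φ m⟩` (by `rfl`). [folklore] -/
@[simp] theorem ofHomULift_hom_apply (φ : M →+ N) (x : ULift.{w} M) :
    (ofHomULift.{w} φ).hom x = ULift.up (φ x.down) :=
  rfl

/-- The reduction `zmodPowAbRed ℓ m : ℤ/ℓᵐ⁺¹ ⟶ ℤ/ℓᵐ` of `EllAdicComparison.lean` is `ofHomULift` of
the transition map `zmodPowTransition ℓ m` of `AddInverseLimit.lean` (by `rfl`). [folklore] -/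
theorem zmodPowAbRed_eq_ofHomULift (ℓ m : ℕ) :
    zmodPowAbRed.{u} ℓ m = ofHomULift.{u} (zmodPowTransition ℓ m) :=
  rfl

end Coefficients

section EtaleCoefficients

variable (X : Scheme.{u}) {A B : Type} [TopologicalSpace A] [AddCommGroup A]
  [IsTopologicalAddGroup A] [TopologicalSpace B] [AddCommGroup B] [IsTopologicalAddGroup B]

/-- **Functoriality of the étale sheaf `U ↦ C(U, A)` in `A`**: the morphism
`continuousMapEtSheaf X A ⟶ continuousMapEtSheaf X B`, `g ↦ φ ∘ g`, induced by a continuous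
additive `φ : A → B` (the restriction to `X_ét` of `continuousMapPresheafAbMap φ hφ`, exactly as
`continuousMapProetSheafMap` on `X_proét`). [folklore] -/
def continuousMapEtSheafMap (φ : A →+ B) (hφ : Continuous φ) :
    continuousMapEtSheaf X A ⟶ continuousMapEtSheaf X B :=
  haveI := isContinuous_etaleForget_forget X
  ((Scheme.Etale.forget X ⋙ Over.forget X).sheafPushforwardContinuous _ _
      Scheme.etaleTopology).map ⟨continuousMapPresheafAbMap φ hφ⟩

/-- On sections, `continuousMapEtSheafMap X φ hφ` is `g ↦ φ ∘ g` (by `rfl`). [folklore] -/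
theorem continuousMapEtSheafMap_hom_app_apply (φ : A →+ B) (hφ : Continuous φ)
    (U : (X.Etale)ᵒᵖ) (g : (continuousMapEtSheaf X A).obj.obj U) :
    (continuousMapEtSheafMap X φ hφ).hom.app U g = (⟨φ, hφ⟩ : C(A, B)).comp g :=
  rfl

end EtaleCoefficients

/-! ### Naturality in the coefficients of the constant-sheaf isomorphisms -/

section ConstantNatural

variable (X : Scheme.{u}) {M N : Type} [AddCommGroup M] [TopologicalSpace M] [DiscreteTopology M]
  [AddCommGroup N] [TopologicalSpace N] [DiscreteTopology N] (φ : M →+ N) (hφ : Continuous φ)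

/-- Milne II 2.18 (a) is natural in the discrete group: the isomorphisms
`M_X ≅ (U ↦ C(U, M))` (`constantSheafIsoContinuousMapEtSheaf`) commute with the maps induced by
`φ : M → N`. [folklore] -/
theorem constantSheafIsoContinuousMapEtSheaf_hom_naturality :
    (constantSheaf X.smallEtaleTopology Ab.{u}).map (ofHomULift.{u} φ) ≫
        (constantSheafIsoContinuousMapEtSheaf X N).hom =
      (constantSheafIsoContinuousMapEtSheaf X M).hom ≫ continuousMapEtSheafMap X φ hφ := by
  haveI := (GrothendieckTopology.W_iff _ _).1 (W_constToContinuousMapEtSheaf X M)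
  haveI := (GrothendieckTopology.W_iff _ _).1 (W_constToContinuousMapEtSheaf X N)
  have h := sheafifyCompIso_hom_naturality (J := X.smallEtaleTopology)
    (constToContinuousMapEtSheaf X M) (constToContinuousMapEtSheaf X N)
    ((Functor.const (X.Etale)ᵒᵖ).map (ofHomULift.{u} φ)) (continuousMapEtSheafMap X φ hφ)
    (by ext U m; rfl)
  exact h

/-- The same with coefficients lifted to `Ab.{u+1}` (`constantSheafULiftIsoContinuousMapEtSheaf`).
[folklore] -/
theorem constantSheafULiftIsoContinuousMapEtSheaf_hom_naturality :
    (constantSheaf X.smallEtaleTopology Ab.{u + 1}).map (ofHomULift.{u + 1} φ) ≫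
        (constantSheafULiftIsoContinuousMapEtSheaf X N).hom =
      (constantSheafULiftIsoContinuousMapEtSheaf X M).hom ≫
        (sheafCompose X.smallEtaleTopology AddCommGrpCat.uliftFunctor.{u + 1}).map
          (continuousMapEtSheafMap X φ hφ) := by
  haveI := (GrothendieckTopology.W_iff _ _).1 (W_constToContinuousMapEtSheafULift X M)
  haveI := (GrothendieckTopology.W_iff _ _).1 (W_constToContinuousMapEtSheafULift X N)
  have h := sheafifyCompIso_hom_naturality (J := X.smallEtaleTopology)
    (constToContinuousMapEtSheafULift X M) (constToContinuousMapEtSheafULift X N)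
    ((Functor.const (X.Etale)ᵒᵖ).map (ofHomULift.{u + 1} φ))
    ((sheafCompose X.smallEtaleTopology AddCommGrpCat.uliftFunctor.{u + 1}).map
      (continuousMapEtSheafMap X φ hφ))
    (by ext U m; rfl)
  exact h

/-- Bhatt–Scholze Lemma 4.2.12 is natural in the discrete group: the isomorphisms
`M_X ≅ F_M` on `X_proét` (`constantSheafIsoContinuousMapProetSheaf`) commute with the maps induced
by `φ : M → N` (`proetSheafMap`). [cite: BhattScholze2015, Lemma 4.2.12] -/
theorem constantSheafIsoContinuousMapProetSheaf_hom_naturality :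
    (constantSheaf (Scheme.ProEt.topology X) Ab.{u + 1}).map (ofHomULift.{u + 1} φ) ≫
        (constantSheafIsoContinuousMapProetSheaf X N).hom =
      (constantSheafIsoContinuousMapProetSheaf X M).hom ≫ proetSheafMap X φ hφ := by
  haveI := (GrothendieckTopology.W_iff _ _).1 (W_constToContinuousMapProetSheaf X M)
  haveI := (GrothendieckTopology.W_iff _ _).1 (W_constToContinuousMapProetSheaf X N)
  have h := sheafifyCompIso_hom_naturality (J := Scheme.ProEt.topology X)
    (constToContinuousMapProetSheaf X M) (constToContinuousMapProetSheaf X N)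
    ((Functor.const (X.ProEt)ᵒᵖ).map (ofHomULift.{u + 1} φ)) (proetSheafMap X φ hφ)
    (by ext U m; rfl)
  exact h

end ConstantNatural

/-! ### Naturality in the coefficients of `ν*(M_X^{ét}) ≅ M_X^{proét}` -/

section PullbackNatural

variable (X : Scheme.{u}) {M N : Type} [AddCommGroup M] [AddCommGroup N] (φ : M →+ N)

/-- The identification `ν*(ulift M_X^{ét}) ≅ M_X^{proét}` (`etaleToProetPullbackULiftConstantIso`)
is natural in the abelian group `M`: it is assembled from Milne II 2.18 (a) in both coefficient
universes (natural by the two previous lemmas, for the discrete topologies) and the natural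
isomorphism `ν* ∘ const_ét ≅ const_proét` (`pullbackConstantSheafIso`).
[cite: BhattScholze2015, Lemma 4.2.12 and Cor. 5.1.9] -/
theorem etaleToProetPullbackULiftConstantIso_hom_naturality :
    (etaleToProetPullbackULift X).map
          ((constantSheaf X.smallEtaleTopology Ab.{u}).map (ofHomULift.{u} φ)) ≫
        (etaleToProetPullbackULiftConstantIso X N).hom =
      (etaleToProetPullbackULiftConstantIso X M).hom ≫
        (constantSheaf (Scheme.ProEt.topology X) Ab.{u + 1}).map (ofHomULift.{u + 1} φ) := by
  letI : TopologicalSpace M := ⊥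
  haveI : DiscreteTopology M := ⟨rfl⟩
  letI : TopologicalSpace N := ⊥
  haveI : DiscreteTopology N := ⟨rfl⟩
  have hφ : Continuous φ := continuous_of_discreteTopology
  -- the square in `Shv(X_ét, Ab.{u+1})`
  have h1 : (sheafCompose X.smallEtaleTopology AddCommGrpCat.uliftFunctor.{u + 1}).map
        ((constantSheaf X.smallEtaleTopology Ab.{u}).map (ofHomULift.{u} φ)) ≫
      (sheafCompose X.smallEtaleTopology AddCommGrpCat.uliftFunctor.{u + 1}).map
          (constantSheafIsoContinuousMapEtSheaf X N).hom ≫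
        (constantSheafULiftIsoContinuousMapEtSheaf X N).inv =
      ((sheafCompose X.smallEtaleTopology AddCommGrpCat.uliftFunctor.{u + 1}).map
          (constantSheafIsoContinuousMapEtSheaf X M).hom ≫
        (constantSheafULiftIsoContinuousMapEtSheaf X M).inv) ≫
        (constantSheaf X.smallEtaleTopology Ab.{u + 1}).map (ofHomULift.{u + 1} φ) := by
    rw [← Functor.map_comp_assoc, constantSheafIsoContinuousMapEtSheaf_hom_naturality X φ hφ,
      Functor.map_comp_assoc, Category.assoc]
    congr 1
    rw [Iso.comp_inv_eq, Category.assoc, Iso.eq_inv_comp,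
      constantSheafULiftIsoContinuousMapEtSheaf_hom_naturality X φ hφ]
  have h2 : (etaleToProetPullback X).map
        ((constantSheaf X.smallEtaleTopology Ab.{u + 1}).map (ofHomULift.{u + 1} φ)) ≫
      (pullbackConstantSheafIso X).hom.app (AddCommGrpCat.of (ULift.{u + 1} N)) =
      (pullbackConstantSheafIso X).hom.app (AddCommGrpCat.of (ULift.{u + 1} M)) ≫
        (constantSheaf (Scheme.ProEt.topology X) Ab.{u + 1}).map (ofHomULift.{u + 1} φ) :=
    (pullbackConstantSheafIso X).hom.naturality (ofHomULift.{u + 1} φ)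
  -- restate the goal with all functors unfolded (definitional)
  show (etaleToProetPullback X).map
        ((sheafCompose X.smallEtaleTopology AddCommGrpCat.uliftFunctor.{u + 1}).map
          ((constantSheaf X.smallEtaleTopology Ab.{u}).map (ofHomULift.{u} φ))) ≫
      (etaleToProetPullback X).map
          ((sheafCompose X.smallEtaleTopology AddCommGrpCat.uliftFunctor.{u + 1}).map
              (constantSheafIsoContinuousMapEtSheaf X N).hom ≫
            (constantSheafULiftIsoContinuousMapEtSheaf X N).inv) ≫
        (pullbackConstantSheafIso X).hom.app (AddCommGrpCat.of (ULift.{u + 1} N)) =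
    ((etaleToProetPullback X).map
          ((sheafCompose X.smallEtaleTopology AddCommGrpCat.uliftFunctor.{u + 1}).map
              (constantSheafIsoContinuousMapEtSheaf X M).hom ≫
            (constantSheafULiftIsoContinuousMapEtSheaf X M).inv) ≫
        (pullbackConstantSheafIso X).hom.app (AddCommGrpCat.of (ULift.{u + 1} M))) ≫
      (constantSheaf (Scheme.ProEt.topology X) Ab.{u + 1}).map (ofHomULift.{u + 1} φ)
  rw [← Functor.map_comp_assoc, h1, Functor.map_comp_assoc, Category.assoc]
  congr 1

end PullbackNatural

/-! ### Naturality of the comparison `Hⁱ(X_ét, F) ≃+ Hⁱ(X_proét, ν*F)` in `F` -/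

section CompareNatural

variable (X : Scheme.{u})
  (hc : ∀ (X : Scheme.{u}) (I : Sheaf X.smallEtaleTopology Ab.{u}), Injective I →
    ∀ p : ℕ, Subsingleton (((etaleToProetPullbackULift X).obj I).H (p + 1)))
  [(etaleToProetPullback X).Full] [(etaleToProetPullback X).Faithful]

/-- The canonical comparison `Hⁱ(X_ét, F) ≃+ Hⁱ(X_proét, ν*F)` of Bhatt–Scholze Cor. 5.1.6
(`sheafHEquivEtaleToProetPullback`, i.e. `Ext.mapExactFunctor (ν* ∘ ulift)` followed by the
transport along `ν*(ulift ℤ_X) ≅ ℤ_X`) is natural in the sheaf `F`: it commutes with the maps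
induced on `Hⁱ` by `f : F ⟶ G` and by `ν*(ulift f)`. [cite: BhattScholze2015, Cor. 5.1.6 and Cor. 5.1.9] -/
theorem sheafHEquivEtaleToProetPullback_naturality {F G : Sheaf X.smallEtaleTopology Ab.{u}}
    (f : F ⟶ G) (i : ℕ) (x : F.H i) :
    sheafHEquivEtaleToProetPullback X hc G i (Sheaf.H.map f i x) =
      Sheaf.H.map ((etaleToProetPullbackULift X).map f) i
        (sheafHEquivEtaleToProetPullback X hc F i x) := by
  simp only [sheafHEquivEtaleToProetPullback, AddEquiv.trans_apply,
    Literature.Algebra.Homology.mapExtAddEquivOfSubsingletonExtObjInjective_apply,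
    Sheaf.H.map_apply]
  change (Abelian.Ext.mk₀ _).comp _ (zero_add i) =
    ((Abelian.Ext.mk₀ _).comp _ (zero_add i)).comp _ (add_zero i)
  rw [Abelian.Ext.mapExactFunctor_comp, Abelian.Ext.mapExactFunctor_mk₀,
    Abelian.Ext.comp_assoc_of_third_deg_zero]

variable {M N : Type} [AddCommGroup M] [TopologicalSpace M] [DiscreteTopology M]
  [AddCommGroup N] [TopologicalSpace N] [DiscreteTopology N]

/-- **`Hⁱ(X_ét, M) ≃+ Hⁱ(X_proét, F_M)` canonically**, for a discrete abelian group `M`: the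
comparison of Cor. 5.1.6 for the constant étale sheaf `M_X` (coefficients `ULift.{u} M ∈ Ab.{u}`,
the carrier of `etaleCohomologyZModPow`), followed by `ν*(ulift M_X^{ét}) ≅ M_X^{proét}`
(`etaleToProetPullbackULiftConstantIso`) and Lemma 4.2.12 `M_X^{proét} ≅ F_M`
(`constantSheafIsoContinuousMapProetSheaf`); the target is `ProetCohomology X M i`. Conditional on
the inputs of `sheafHEquivEtaleToProetPullback` (full faithfulness of `ν*` as instances,
acyclicity `hc`). [cite: BhattScholze2015, Cor. 5.1.6 and Lemma 4.2.12] -/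
def etaleConstHEquivProetCohomology (M : Type) [AddCommGroup M] [TopologicalSpace M]
    [DiscreteTopology M] (i : ℕ) :
    (((constantSheaf X.smallEtaleTopology Ab.{u}).obj (AddCommGrpCat.of (ULift.{u} M))).H i :
        Type u) ≃+ (proetSheaf X M).H i :=
  (sheafHEquivEtaleToProetPullback X hc _ i).trans
    ((addEquivHOfIso (etaleToProetPullbackULiftConstantIso X M) i).trans
      (addEquivHOfIso (constantSheafIsoContinuousMapProetSheaf X M) i))

/-- **The comparison `Hⁱ(X_ét, M) ≃+ Hⁱ(X_proét, F_M)` is natural in the coefficients**: for a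
homomorphism `φ : M → N` of discrete abelian groups it intertwines `Hⁱ(X_ét, M_X → N_X)` with
`Hⁱ(X_proét, F_M → F_N)` (`ProetCohomology.map`). [cite: BhattScholze2015, Cor. 5.1.6 and Lemma 4.2.12] -/
theorem etaleConstHEquivProetCohomology_naturality (φ : M →+ N) (hφ : Continuous φ) (i : ℕ)
    (x : ((constantSheaf X.smallEtaleTopology Ab.{u}).obj (AddCommGrpCat.of (ULift.{u} M))).H i) :
    etaleConstHEquivProetCohomology X hc N i
        (Sheaf.H.map ((constantSheaf X.smallEtaleTopology Ab.{u}).map (ofHomULift.{u} φ)) i x) =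
      Sheaf.H.map (proetSheafMap X φ hφ) i (etaleConstHEquivProetCohomology X hc M i x) := by
  have hmor : ((etaleToProetPullbackULift X).map
        ((constantSheaf X.smallEtaleTopology Ab.{u}).map (ofHomULift.{u} φ)) ≫
      (etaleToProetPullbackULiftConstantIso X N).hom) ≫
        (constantSheafIsoContinuousMapProetSheaf X N).hom =
      ((etaleToProetPullbackULiftConstantIso X M).hom ≫
        (constantSheafIsoContinuousMapProetSheaf X M).hom) ≫ proetSheafMap X φ hφ := by
    rw [etaleToProetPullbackULiftConstantIso_hom_naturality, Category.assoc, Category.assoc,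
      constantSheafIsoContinuousMapProetSheaf_hom_naturality X φ hφ]
  simp only [etaleConstHEquivProetCohomology, AddEquiv.trans_apply, addEquivHOfIso_apply]
  rw [sheafHEquivEtaleToProetPullback_naturality]
  simp only [← Sheaf.H.map_comp_apply]
  rw [hmor]

end CompareNatural

/-! ### The two towers `Hⁱ(Y_ét, ℤ/ℓᵐ)` and `Hⁱ(Y_proét, ℤ/ℓᵐ)` are isomorphic as towers -/

section Towers

variable (Y : Scheme.{u})
  (hc : ∀ (X : Scheme.{u}) (I : Sheaf X.smallEtaleTopology Ab.{u}), Injective I →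
    ∀ p : ℕ, Subsingleton (((etaleToProetPullbackULift X).obj I).H (p + 1)))
  [(etaleToProetPullback Y).Full] [(etaleToProetPullback Y).Faithful] (ℓ : ℕ)

/-- **`Hⁱ(Y_ét, ℤ/ℓᵐ) ≃+ Hⁱ(Y_proét, ℤ/ℓᵐ)`** (Bhatt–Scholze Cor. 5.1.6 with Lemma 4.2.12 for the
constant sheaf `ℤ/ℓᵐ`): `etaleConstHEquivProetCohomology` for `M = ZMod (ℓ ^ m)`, between the
groups of the étale tower `etaleCohomologyZModPow` (`EllAdicComparison.lean`) and of the pro-étale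
tower `proetCohomologyZModPow` (`ProetLimOneSequence.lean`).
[cite: BhattScholze2015, Cor. 5.1.6 and Lemma 4.2.12] -/
def etaleProetZModPowEquiv (i m : ℕ) :
    etaleCohomologyZModPow Y ℓ i m ≃+ proetCohomologyZModPow Y ℓ i m :=
  etaleConstHEquivProetCohomology Y hc (ZMod (ℓ ^ m)) i

/-- **The comparison is an isomorphism of towers**: it intertwines the reductions
`Hⁱ(Y_ét, ℤ/ℓᵐ⁺¹) → Hⁱ(Y_ét, ℤ/ℓᵐ)` (`etaleCohomologyZModPowMap`) and
`Hⁱ(Y_proét, ℤ/ℓᵐ⁺¹) → Hⁱ(Y_proét, ℤ/ℓᵐ)` (`proetCohomologyZModPowMap`) — naturality of Cor. 5.1.6 in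
the coefficients `ℤ/ℓᵐ⁺¹ → ℤ/ℓᵐ`. [cite: BhattScholze2015, Cor. 5.1.6 and Lemma 4.2.12] -/
theorem etaleProetZModPowEquiv_map (i m : ℕ) (x : etaleCohomologyZModPow Y ℓ i (m + 1)) :
    etaleProetZModPowEquiv Y hc ℓ i m (etaleCohomologyZModPowMap Y ℓ i m x) =
      proetCohomologyZModPowMap Y ℓ i m (etaleProetZModPowEquiv Y hc ℓ i (m + 1) x) :=
  etaleConstHEquivProetCohomology_naturality Y hc (zmodPowTransition ℓ m)
    continuous_of_discreteTopology i x

/-- `lim¹_m Hⁱ(Y_ét, ℤ/ℓᵐ) ≃+ lim¹_m Hⁱ(Y_proét, ℤ/ℓᵐ)` along the isomorphism of towers.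
[cite: BhattScholze2015, Cor. 5.1.6] -/
def towerLimOneEtaleProetEquiv (i : ℕ) :
    TowerLimOne (etaleCohomologyZModPowMap Y ℓ i) ≃+
      TowerLimOne (proetCohomologyZModPowMap Y ℓ i) :=
  towerLimOneCongr (etaleCohomologyZModPowMap Y ℓ i) (proetCohomologyZModPowMap Y ℓ i)
    (etaleProetZModPowEquiv Y hc ℓ i) (etaleProetZModPowEquiv_map Y hc ℓ i)

/-- `lim_m Hⁱ(Y_ét, ℤ/ℓᵐ) ≃+ lim_m Hⁱ(Y_proét, ℤ/ℓᵐ)` along the isomorphism of towers.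
[cite: BhattScholze2015, Cor. 5.1.6] -/
def towerLimEtaleProetEquiv (i : ℕ) :
    towerLim (etaleCohomologyZModPowMap Y ℓ i) ≃+ towerLim (proetCohomologyZModPowMap Y ℓ i) :=
  towerLimCongr (etaleCohomologyZModPowMap Y ℓ i) (proetCohomologyZModPowMap Y ℓ i)
    (etaleProetZModPowEquiv Y hc ℓ i) (etaleProetZModPowEquiv_map Y hc ℓ i)

end Towers

/-! ### Bhatt–Scholze Prop. 5.6.2 for `(ℤ/ℓᵐ)_m`, étale towers -/

/-- **The `lim¹` sequence with étale towers, from the acyclicity of injective étale sheaves on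
`X_proét`.** If `Hᵖ⁺¹(X_proét, ν*I) = 0` for every scheme `X`, every injective abelian étale sheaf
`I` and every `p` (the residual proof obligation of Bhatt–Scholze Cor. 5.1.6, the hypothesis `hc`
of `EtaleToProetExt.lean`), then `ellAdicCohomology_limOneSequence` holds: for every scheme `Y`,
prime `ℓ` and `i` there are `δ : lim¹_m Hⁱ(Y_ét, ℤ/ℓᵐ) → Hⁱ⁺¹_proét(Y, ℤ_ℓ)` injective and
`ρ : Hⁱ⁺¹_proét(Y, ℤ_ℓ) → lim_m Hⁱ⁺¹(Y_ét, ℤ/ℓᵐ)` surjective with `range δ = ker ρ`. Proof: the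
pro-étale `lim¹` sequence `proetCohomology_limOneSequence_of_piComparison` (long exact sequence of
`0 → F_{ℤ_ℓ} → F_{∏ℤ/ℓᵐ} → F_{∏ℤ/ℓᵐ} → 0`, Prop. 3.1.10–3.1.11), unconditional since
`bijective_piComparison_proetCohomology_holds` (Prop. 3.1.9), transported along the isomorphism of
towers `Hⁱ(Y_ét, ℤ/ℓᵐ) ≃+ Hⁱ(Y_proét, ℤ/ℓᵐ)` (Cor. 5.1.6 + Lemma 4.2.12, natural in `m`;
`full_faithful_etaleToProetPullback_holds` supplies Lemma 5.1.2); `Hⁱ⁺¹_proét(Y, ℤ_ℓ)` is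
`ProetCohomology Y ℤ_[ℓ] (i + 1)` by `rfl` (Def. 6.8.1, Lemma 6.8.2).
[cite: BhattScholze2015, Prop. 5.6.2, Cor. 5.1.6, Prop. 3.1.10–3.1.11] -/
theorem ellAdicCohomology_limOneSequence_of_acyclic
    (hc : ∀ (X : Scheme.{u}) (I : Sheaf X.smallEtaleTopology Ab.{u}), Injective I →
      ∀ p : ℕ, Subsingleton (((etaleToProetPullbackULift X).obj I).H (p + 1))) :
    ellAdicCohomology_limOneSequence.{u} := by
  intro Y ℓ _ i
  haveI := (full_faithful_etaleToProetPullback_holds.{u} Y).1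
  haveI := (full_faithful_etaleToProetPullback_holds.{u} Y).2
  obtain ⟨δ₀, hδ₀, hρ₀, hex⟩ := proetCohomology_limOneSequence_of_piComparison Y ℓ
    bijective_piComparison_proetCohomology_holds.{u} i
  obtain ⟨h₁, h₂, h₃⟩ := exact_pair_congr δ₀ (ProetCohomology.toTowerLim Y ℓ (i + 1))
    (towerLimOneEtaleProetEquiv Y hc ℓ i) (towerLimEtaleProetEquiv Y hc ℓ (i + 1)).symm hδ₀ hρ₀ hex
  exact ⟨δ₀.comp (towerLimOneEtaleProetEquiv Y hc ℓ i).toAddMonoidHom,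
    (towerLimEtaleProetEquiv Y hc ℓ (i + 1)).symm.toAddMonoidHom.comp
      (ProetCohomology.toTowerLim Y ℓ (i + 1)), h₁, h₂, h₃⟩

/-- **Bhatt–Scholze Prop. 5.6.2 (`ellAdicCohomology_limOneSequence`) from Cor. 5.1.6
(`nonempty_addEquiv_sheafH_etaleToProetPullback`)**: the trust base of the `lim¹` sequence with
étale towers is exactly the pro-étale/étale comparison for abelian étale sheaves (which implies the
acyclicity of the `ν*I`, `subsingleton_sheafH_etaleToProetPullbackULift_of_pullback`); repleteness /
exactness of countable products (Prop. 3.1.9), full faithfulness of `ν*` (Lemma 5.1.2),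
`ν*(ℤ/ℓᵐ) = F_{ℤ/ℓᵐ}` (Lemma 4.2.12) and `lim F_{ℤ/ℓᵐ} = F_{ℤ_ℓ}` (Lemma 6.8.2) are all proved in
this cluster. [cite: BhattScholze2015, Prop. 5.6.2 and Cor. 5.1.6] -/
theorem ellAdicCohomology_limOneSequence_of_pullback
    (h : nonempty_addEquiv_sheafH_etaleToProetPullback.{u}) :
    ellAdicCohomology_limOneSequence.{u} :=
  ellAdicCohomology_limOneSequence_of_acyclic
    (subsingleton_sheafH_etaleToProetPullbackULift_of_pullback h)

end Literature.AlgebraicGeometry.Motives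

end
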